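/-
Copyright: cell pub-balaban-gaps, seat ne8 (estimate NE7c), gen 14. Project licence.
-/
import Summits.QuantumFields.BalabanUV.T4Continuum.Spine.NE7b.CompactFibreHalvedActionSUN
import Summits.QuantumFields.BalabanUV.T4Continuum.Spine.NE7b.CompactFibreWindowSU2DoublingHaar
import Summits.QuantumFields.BalabanUV.T4Continuum.Spine.NE7b.CompactFibreHalvedActionSU2Sharp
import Summits.QuantumFields.BalabanUV.T4Continuum.Spine.NE7c.LiveFactorLCS

/-!
# Road (δ) on the DOUBLING window-volume function of the (n)-carrier (ne6's V38 ∕ V40c ∕ V40d): at a live window the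
# volume letter is the UNLOWERED letter times `ν^{½d(𝔤)}` — print's letter survives VERBATIM (rate AND constant), the live
# factor is a separate multiplicative `ν₀^{½d(𝔤)}` per plaquette variable with constant `D` (all `N`) and `1` (`N = 2`,
# SHARP) —, and the halved-action (LCS) letter of the reference state is THRESHOLD-FREE and of degree `0` in `ℓ = log g⁻²`
# (row NE7c; junction J-16)

Cell `pub-balaban-gaps` (G2), seat ne8, estimate **NE7c** (`T4IndicatorShell.ShellWeightBound`; two-run artefact, NOT PRINTED in
[Bałaban 1983–89], NOT PROVED).  Proof-only file under `Spine/NE7c/`: seat ne6 GEN 16's census files V38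
`Spine/NE7b/CompactFibreHalvedActionSUN` (window DOUBLING of Haar on `SU(N)` with exponent `N² − 1 = d(𝔤)` at ALL radii, and the
halved-action letter of the product-Haar reference state, β-free at rate `½d(𝔤)`), V40c `Spine/NE7b/CompactFibreWindowSU2DoublingHaar`
(doubling on `SU(2)` with the SHARP constant `D = 1`, from V40a's exact cap law) and V40d `Spine/NE7b/CompactFibreHalvedActionSU2Sharp`
(the `SU(2)` LCS letter with `c = 0`) consumed BY NAME at road (δ)'s live letters, plus this seat's file 15 `LiveFactorLCS` (the live
cost–volume ledger's dominance clause BY NAME).  Nothing of Bałaban's is named; no `def`; 0 `sorry`.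

THE QUESTION (seat census `HOME/ne/NE7c.md` §21, row 48).  Road (δ) (threshold randomisation, `Lit.T4ShellMeasure` §6–§8) lowers every
live small-field window by a factor chosen ONCE for the grid of assignments: the trace window `W_t = {Re tr(1 − V) ≤ t}` becomes `W_{νt}`,
`ν ∈ [ν₀, 1]`.  Files 24 ∕ 27 priced the LOWER-bound use of the window volume at a live window through ne6's TWO-SIDED laws, so the live pin
carried the sandwich constants (`log 16`; `log 160`, `log 12`) next to the live loss, on the radii where the law holds.  V38 ∕ V40c now
display the window-volume FUNCTION's DOUBLING — `Haar(W_{λ²t}) ≤ D·λ^{N²−1}·Haar(W_t)`, all `λ ≥ 1`, all real `t`; `D = 1` for `N = 2`.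
Read at `λ = (√ν)⁻¹`: what is the live factor's price RELATIVE TO THE UNLOWERED LETTER, at every radius?

WHAT IS PROVED ([folklore]; ne6's theorems BY NAME at `λ := (√ν)⁻¹`, `t := νt`, plus real arithmetic):
* §0 ABSTRACT: for ANY window function `m` doubling with exponent `k` and constant `D` (`m(λ²t) ≤ D·λᵏ·m(t)`, `λ ≥ 1`):
  `live_lower_of_doubling` (`(√ν)ᵏ·m(t) ≤ D·m(νt)`, `0 < ν ≤ 1`), `…_grid` (`(√ν₀)ᵏ·m(t) ≤ D·m(νt)` for every `ν ∈ [ν₀, 1]` — ONE price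
  for the grid), `neg_log_live_le_of_doubling` (`−log m(νt) ≤ −log m(t) + log D + (k∕2)·log ν⁻¹`: the unlowered letter VERBATIM plus
  the live shift), `letter_live_of_doubling` (ANY valid letter `−log m(t) ≤ L` reads `−log m(νt) ≤ L + log D + (k∕2)·log ν₀⁻¹` at a live
  window — no rate shape, no radius range asked of `L`).
* §1 `SU(N)`, ALL `N` (V38 BY NAME): `exists_live_traceWindow_ge` (`(√ν)^{N²−1}·Haar(W_t) ≤ D·Haar(W_{νt})`, all real `t`),
  `exists_live_sball_ge` (Hilbert–Schmidt radius form, factor `μ^{N²−1}` at radius `μη`), `exists_neg_log_live_traceWindow_le` (log form on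
  the grid: `+ c + ((N²−1)∕2)·log ν₀⁻¹`, `c = log D`), and the REGION forms on the product Haar of `bonds → SU(N)`:
  `exists_live_pi_traceWindow_ge` ∕ `exists_neg_log_live_pi_traceWindow_le` (`−log κ(Π_b W_{νt}) ≤ −log κ(Π_b W_t) + #bonds·(c +
  ((N²−1)∕2)·log ν₀⁻¹)`).
* §2 `SU(2)` SHARP (V40c BY NAME): `live_traceWindow_ge_sharp` (`(√ν)³·Haar(W_t) ≤ Haar(W_{νt})` — constant `1`),
  `neg_log_live_traceWindow_le_sharp` (`−log Haar(W_{νt}) ≤ −log Haar(W_t) + (3∕2)·log ν⁻¹`), the letter transfer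
  **`letter_live_sharp`** (ANY letter `−log Haar(W_t) ≤ L` ⟹ `−log Haar(W_{νt}) ≤ L + (3∕2)·log ν₀⁻¹` — [Balaban1989LargeFieldII] (1.10)'s
  shape `−½d(𝔤)·log g_k⁻² + log σ₀` keeps its rate AND its constant, the live factor is the separate summand `½d(𝔤)·log ν₀⁻¹`), and the
  region forms `live_pi_traceWindow_ge_sharp` ∕ **`neg_log_live_pi_traceWindow_le_sharp`** (`−log κ(Π_b W_{νt}) ≤ −log κ(Π_b W_t) +
  #bonds·(3∕2)·log ν₀⁻¹`, NO sandwich constant — files 24∕27's live pins with `log 16` ∕ `log 160 + log 12` replaced by `0`).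
* §3 THE HALVED-ACTION (LCS) LETTER AT LIVE LETTERS: V38's `exists_lcsLetter_compactFibre` ∕ V40d's `lcsLetter_SU2_sharp` carry NO window or
  threshold letter (the sacrificed fraction `δ` of the region's Wilson action, all `β ≥ 0`) — the SAME `b = #B·(½d(𝔤)·log(1−δ)⁻¹ + c)` serves
  every assignment (file 15's word «stability half letter-blind GIVEN `b`»: here `b` itself is assignment-free).  The one place road (δ) meets it
  is file 15's ledger clause `b ≤ κ·a₁`, `κ = λ₀²∕2`: the per-plaquette letter `b₀ = ½d(𝔤)·log(1−δ)⁻¹ + c` is of DEGREE `0` in `ℓ = log g⁻²`,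
  so below ONE `g⋆(λ₀)` it is dominated by half the live fraction of ANY extraction profile `A·ℓᵖ`, `p ≥ 1` —
  `lcsLetter_dominated_live_of_g_small` (file 15's `dominance_live_of_g_small` at `q = 0` BY NAME), `lcsLetter_SU2_dominated_live_of_g_small`
  (`(3∕2)·log(1−δ)⁻¹ ≤ (λ₀²∕2)·A·ℓ(g)ᵖ` for `0 < g ≤ exp(−½·max 1 (3·log(1−δ)⁻¹∕(λ₀²A)))`).
* §4 sanity: at `ν = 1` §2 is `Haar(W_t) ≤ Haar(W_t)`.

CENSUS (row 48, NEW; `HOME/ne/NE7c.md` §21): in the window-VOLUME currency the live factor's price RELATIVE TO THE UNLOWERED LETTER is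
exactly multiplicative `ν^{½d(𝔤)}` per plaquette variable at EVERY radius (doubling; constant `D` for all `N`, `1` for `N = 2`), so EVERY
window-volume letter the lineage or print displays — two-sided, explicit (V33∕V36), profile-folded, or (1.10) itself — transfers to the live
window with its rate AND constant untouched plus the separate summand `½d(𝔤)·log ν₀⁻¹` (row 47 (i) SHARPENED: no sandwich constant, no
radius range; MILD, a bounded `k`-uniform shift of a normalisation constant); the halved-action ∕ LCS letter of the reference state is FREE
(threshold-free `b`), and its meeting with the live ledger is a degree-`0`-vs-degree-`p` dominance below one `g⋆(λ₀)` — NO clause on `λ₀`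
(row 48 (ii)).  BY-NAME EFFECT ON THE WALL: none (junction ∕ census file).

NOT HERE (honest): the TIGHTNESS of `ν^{3∕2}` as `t → 0⁺` (from V40a's exact law; not typed); `SU(3)`'s sharp constant; which `t(g_k)`,
`δ`, region `Z` Bałaban's step carries and that its creation-level carrier IS the (n)-carrier — ne6's (A3) ∕ (A1c) list applies verbatim
(NC-NE7b-α UNRULED); node O; NE7c.  VERDICT WORD UNCHANGED: WORK-bound behind node O; INSTANCE 0∕1.  NE7c ∕ NE7b NOT PRINTED ∕ NOT
PROVED; spine 0∕9; one finite T⁴ — NOT ℝ⁴, NOT infinite volume, NOT the mass gap, NOT Clay.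
HONEST DEPENDENCY (cell): continuum YM on T⁴ ⇐ BetaPertH ∧ nine spine estimates (0∕9 proved); BetaPertH ⇐ (D1) ∧ (D4) ∧ CAP+tail.
-/

set_option autoImplicit false

noncomputable section

open MeasureTheory Real Finset
open scoped Matrix.Norms.Frobenius
open Literature.MathematicalPhysics.QuantumFieldTheory (haarProbability)
open Literature.MathematicalPhysics.QuantumFieldTheory.Balaban1983to89 (p0Profile)
open Summit.QuantumFields.BalabanUV.T4Continuum.NE7b.CompactFibreHalvedActionSUN (exists_haarReal_sball_doubling
  exists_haarReal_traceWindow_doubling)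
open Summit.QuantumFields.BalabanUV.T4Continuum.NE7b.CompactFibreWindowSU2DoublingHaar (haarReal_traceWindow_doubling_one)
open Summit.QuantumFields.BalabanUV.T4Continuum.Spine.NE7c.LiveFactorLCS (dominance_live_of_g_small)

namespace Summit.QuantumFields.BalabanUV.T4Continuum.Spine.NE7c.LiveFactorWindowDoubling

/-! ## §0 Abstract: a doubling window function at a live window -/

/-- `1 ≤ (√ν)⁻¹` for `0 < ν ≤ 1`: the doubling parameter of a live window. [folklore] -/
theorem one_le_inv_sqrt {ν : ℝ} (hν0 : 0 < ν) (hν1 : ν ≤ 1) : 1 ≤ (Real.sqrt ν)⁻¹ := by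
  rw [one_le_inv₀ (Real.sqrt_pos.2 hν0)]
  calc Real.sqrt ν ≤ Real.sqrt 1 := Real.sqrt_le_sqrt hν1
    _ = 1 := Real.sqrt_one

/-- **A DOUBLING WINDOW FUNCTION AT A LIVE WINDOW.**  If `m(λ²·t) ≤ D·λᵏ·m(t)` for all `λ ≥ 1` and all `t`, then for a live factor
`0 < ν ≤ 1`: `(√ν)ᵏ·m(t) ≤ D·m(ν·t)` — the unlowered letter bounds the live one up to the multiplicative `ν^{k∕2}`. [folklore] -/
theorem live_lower_of_doubling {m : ℝ → ℝ} {D : ℝ} {k : ℕ}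
    (hdoub : ∀ l : ℝ, 1 ≤ l → ∀ t : ℝ, m (l ^ 2 * t) ≤ D * l ^ k * m t)
    {ν : ℝ} (hν0 : 0 < ν) (hν1 : ν ≤ 1) (t : ℝ) :
    Real.sqrt ν ^ k * m t ≤ D * m (ν * t) := by
  have hk : 0 < Real.sqrt ν ^ k := pow_pos (Real.sqrt_pos.2 hν0) k
  have h := hdoub (Real.sqrt ν)⁻¹ (one_le_inv_sqrt hν0 hν1) (ν * t)
  rw [inv_pow, Real.sq_sqrt hν0.le, ← mul_assoc, inv_mul_cancel₀ hν0.ne', one_mul] at h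
  calc Real.sqrt ν ^ k * m t ≤ Real.sqrt ν ^ k * (D * (Real.sqrt ν)⁻¹ ^ k * m (ν * t)) :=
        mul_le_mul_of_nonneg_left h hk.le
    _ = D * (Real.sqrt ν ^ k * (Real.sqrt ν ^ k)⁻¹) * m (ν * t) := by rw [inv_pow]; ring
    _ = D * m (ν * t) := by rw [mul_inv_cancel₀ hk.ne', mul_one]

/-- **ONE PRICE FOR THE GRID.**  Under the same doubling and `m ≥ 0`: `(√ν₀)ᵏ·m(t) ≤ D·m(ν·t)` for EVERY `ν ∈ [ν₀, 1]`, `ν₀ > 0` —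
the factor `ν₀^{k∕2}` is assignment-free. [folklore] -/
theorem live_lower_of_doubling_grid {m : ℝ → ℝ} {D : ℝ} {k : ℕ}
    (hdoub : ∀ l : ℝ, 1 ≤ l → ∀ t : ℝ, m (l ^ 2 * t) ≤ D * l ^ k * m t) (hm0 : ∀ t, 0 ≤ m t)
    {ν ν₀ : ℝ} (hν₀ : 0 < ν₀) (hν : ν₀ ≤ ν) (hν1 : ν ≤ 1) (t : ℝ) :
    Real.sqrt ν₀ ^ k * m t ≤ D * m (ν * t) := by
  have hle : Real.sqrt ν₀ ^ k ≤ Real.sqrt ν ^ k := pow_le_pow_left₀ (Real.sqrt_nonneg _) (Real.sqrt_le_sqrt hν) k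
  exact (mul_le_mul_of_nonneg_right hle (hm0 t)).trans (live_lower_of_doubling hdoub (hν₀.trans_le hν) hν1 t)

/-- **THE UNLOWERED LETTER VERBATIM PLUS THE LIVE SHIFT** (log form): under the doubling with `D > 0`, at a window of positive
volume, `m(ν·t) > 0` and `−log m(ν·t) ≤ −log m(t) + log D + (k∕2)·log ν⁻¹` (`0 < ν ≤ 1`). [folklore] -/
theorem neg_log_live_le_of_doubling {m : ℝ → ℝ} {D : ℝ} {k : ℕ} (hD : 0 < D)
    (hdoub : ∀ l : ℝ, 1 ≤ l → ∀ t : ℝ, m (l ^ 2 * t) ≤ D * l ^ k * m t)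
    {ν : ℝ} (hν0 : 0 < ν) (hν1 : ν ≤ 1) {t : ℝ} (hmt : 0 < m t) :
    0 < m (ν * t) ∧ -Real.log (m (ν * t)) ≤ -Real.log (m t) + Real.log D + (k : ℝ) / 2 * Real.log ν⁻¹ := by
  have h := live_lower_of_doubling hdoub hν0 hν1 t
  have hsk : 0 < Real.sqrt ν ^ k := pow_pos (Real.sqrt_pos.2 hν0) k
  have hL : 0 < Real.sqrt ν ^ k * m t := mul_pos hsk hmt
  have hpos : 0 < m (ν * t) := pos_of_mul_pos_right (hL.trans_le h) hD.le
  refine ⟨hpos, ?_⟩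
  have hlog := Real.log_le_log hL h
  rw [Real.log_mul hsk.ne' hmt.ne', Real.log_mul hD.ne' hpos.ne', Real.log_pow, Real.log_sqrt hν0.le] at hlog
  have e1 : (k : ℝ) * (Real.log ν / 2) = (k : ℝ) * Real.log ν / 2 := by ring
  have e2 : (k : ℝ) / 2 * Real.log ν⁻¹ = -((k : ℝ) * Real.log ν / 2) := by rw [Real.log_inv]; ring
  rw [e1] at hlog; rw [e2]; linarith

/-- `(k∕2)·log ν⁻¹ ≤ (k∕2)·log ν₀⁻¹` for `0 < ν₀ ≤ ν`: the grid's worst live factor. [folklore] -/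
theorem half_mul_log_inv_le {k ν ν₀ : ℝ} (hk : 0 ≤ k) (hν₀ : 0 < ν₀) (hν : ν₀ ≤ ν) :
    k / 2 * Real.log ν⁻¹ ≤ k / 2 * Real.log ν₀⁻¹ := by
  apply mul_le_mul_of_nonneg_left _ (by positivity)
  rw [Real.log_inv, Real.log_inv]; linarith [Real.log_le_log hν₀ hν]

/-- **ANY LETTER TRANSFERS TO THE LIVE WINDOW** (abstract): under the doubling with `D > 0`, a valid letter `−log m(t) ≤ L` at a window of
positive volume reads `−log m(ν·t) ≤ L + log D + (k∕2)·log ν₀⁻¹` for every `ν ∈ [ν₀, 1]`, `ν₀ > 0` — NO rate shape and NO radius range is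
asked of `L` (contrast file 27's `letter_live_of_rate`). [folklore] -/
theorem letter_live_of_doubling {m : ℝ → ℝ} {D : ℝ} {k : ℕ} (hD : 0 < D)
    (hdoub : ∀ l : ℝ, 1 ≤ l → ∀ t : ℝ, m (l ^ 2 * t) ≤ D * l ^ k * m t)
    {ν ν₀ t L : ℝ} (hν₀ : 0 < ν₀) (hν : ν₀ ≤ ν) (hν1 : ν ≤ 1) (hmt : 0 < m t) (hL : -Real.log (m t) ≤ L) :
    0 < m (ν * t) ∧ -Real.log (m (ν * t)) ≤ L + Real.log D + (k : ℝ) / 2 * Real.log ν₀⁻¹ := by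
  obtain ⟨hpos, h⟩ := neg_log_live_le_of_doubling hD hdoub (hν₀.trans_le hν) hν1 hmt
  exact ⟨hpos, by linarith [half_mul_log_inv_le (k := (k : ℝ)) (Nat.cast_nonneg k) hν₀ hν]⟩

/-! ## §1 `SU(N)`, all `N`: V38's doubling BY NAME at a live window -/

section SUN

variable {N : ℕ}

/-- **THE LIVE TRACE WINDOW HOLDS `ν^{½(N²−1)}` OF THE UNLOWERED ONE, UP TO `D`**: there is `D ≥ 1` (V38's doubling constant) with
`(√ν)^{N²−1}·Haar_{SU(N)}{Re tr(1 − V) ≤ t} ≤ D·Haar_{SU(N)}{Re tr(1 − V) ≤ ν·t}` for ALL `0 < ν ≤ 1` and ALL real `t`. [folklore] -/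
theorem exists_live_traceWindow_ge : ∃ D : ℝ, 1 ≤ D ∧ ∀ ν : ℝ, 0 < ν → ν ≤ 1 → ∀ t : ℝ,
    Real.sqrt ν ^ (N ^ 2 - 1) * (haarProbability (Matrix.specialUnitaryGroup (Fin N) ℂ)).real
        {V : Matrix.specialUnitaryGroup (Fin N) ℂ | (Matrix.trace (1 - (V : Matrix (Fin N) (Fin N) ℂ))).re ≤ t}
      ≤ D * (haarProbability (Matrix.specialUnitaryGroup (Fin N) ℂ)).real
        {V : Matrix.specialUnitaryGroup (Fin N) ℂ | (Matrix.trace (1 - (V : Matrix (Fin N) (Fin N) ℂ))).re ≤ ν * t} := by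
  obtain ⟨D, hD, h⟩ := exists_haarReal_traceWindow_doubling (N := N)
  refine ⟨D, hD, fun ν hν0 hν1 t => ?_⟩
  set μ := haarProbability (Matrix.specialUnitaryGroup (Fin N) ℂ) with hμ
  have key := live_lower_of_doubling (D := D) (k := N ^ 2 - 1)
    (m := fun s => μ.real {V : Matrix.specialUnitaryGroup (Fin N) ℂ | (Matrix.trace (1 - (V : Matrix (Fin N) (Fin N) ℂ))).re ≤ s})
    (fun l hl s => by
      show μ.real _ ≤ D * l ^ (N ^ 2 - 1) * μ.real _
      exact h l hl s) hν0 hν1 t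
  simpa only using key

/-- **HILBERT–SCHMIDT RADIUS FORM**: there is `D ≥ 1` with `μ^{N²−1}·Haar_{SU(N)}{‖V − 1‖ ≤ η} ≤ D·Haar_{SU(N)}{‖V − 1‖ ≤ μ·η}` for ALL
radius factors `0 < μ ≤ 1` and ALL `η ≥ 0` (V38's `exists_haarReal_sball_doubling` at `λ = μ⁻¹`, radius `μη`). [folklore] -/
theorem exists_live_sball_ge : ∃ D : ℝ, 1 ≤ D ∧ ∀ μ : ℝ, 0 < μ → μ ≤ 1 → ∀ η : ℝ, 0 ≤ η →
    μ ^ (N ^ 2 - 1) * (haarProbability (Matrix.specialUnitaryGroup (Fin N) ℂ)).real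
        {V : Matrix.specialUnitaryGroup (Fin N) ℂ | ‖(V : Matrix (Fin N) (Fin N) ℂ) - 1‖ ≤ η}
      ≤ D * (haarProbability (Matrix.specialUnitaryGroup (Fin N) ℂ)).real
        {V : Matrix.specialUnitaryGroup (Fin N) ℂ | ‖(V : Matrix (Fin N) (Fin N) ℂ) - 1‖ ≤ μ * η} := by
  obtain ⟨D, hD, h⟩ := exists_haarReal_sball_doubling (N := N)
  refine ⟨D, hD, fun μ hμ0 hμ1 η hη => ?_⟩
  set d : ℕ := N ^ 2 - 1 with hd
  have hμd : 0 < μ ^ d := pow_pos hμ0 d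
  have h' := h μ⁻¹ (by rw [one_le_inv₀ hμ0]; exact hμ1) (μ * η) (mul_nonneg hμ0.le hη)
  rw [← mul_assoc, inv_mul_cancel₀ hμ0.ne', one_mul] at h'
  calc μ ^ d * (haarProbability (Matrix.specialUnitaryGroup (Fin N) ℂ)).real
          {V : Matrix.specialUnitaryGroup (Fin N) ℂ | ‖(V : Matrix (Fin N) (Fin N) ℂ) - 1‖ ≤ η}
        ≤ μ ^ d * (D * μ⁻¹ ^ d * (haarProbability (Matrix.specialUnitaryGroup (Fin N) ℂ)).real
          {V : Matrix.specialUnitaryGroup (Fin N) ℂ | ‖(V : Matrix (Fin N) (Fin N) ℂ) - 1‖ ≤ μ * η}) :=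
        mul_le_mul_of_nonneg_left h' hμd.le
    _ = D * (μ ^ d * (μ ^ d)⁻¹) * (haarProbability (Matrix.specialUnitaryGroup (Fin N) ℂ)).real
          {V : Matrix.specialUnitaryGroup (Fin N) ℂ | ‖(V : Matrix (Fin N) (Fin N) ℂ) - 1‖ ≤ μ * η} := by rw [inv_pow]; ring
    _ = _ := by rw [mul_inv_cancel₀ hμd.ne', mul_one]

/-- **LOG FORM ON THE GRID, ALL `N`**: there is `c ≥ 0` (`= log D`) such that for every `ν₀ > 0`, every live factor `ν ∈ [ν₀, 1]` and every
trace window of positive Haar volume, the live window has positive volume and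
`−log Haar(W_{νt}) ≤ −log Haar(W_t) + c + ((N² − 1)∕2)·log ν₀⁻¹` — the unlowered letter verbatim, the live factor a separate summand. [folklore] -/
theorem exists_neg_log_live_traceWindow_le : ∃ c : ℝ, 0 ≤ c ∧ ∀ ν₀ ν : ℝ, 0 < ν₀ → ν₀ ≤ ν → ν ≤ 1 → ∀ t : ℝ,
    0 < (haarProbability (Matrix.specialUnitaryGroup (Fin N) ℂ)).real
        {V : Matrix.specialUnitaryGroup (Fin N) ℂ | (Matrix.trace (1 - (V : Matrix (Fin N) (Fin N) ℂ))).re ≤ t} →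
    0 < (haarProbability (Matrix.specialUnitaryGroup (Fin N) ℂ)).real
        {V : Matrix.specialUnitaryGroup (Fin N) ℂ | (Matrix.trace (1 - (V : Matrix (Fin N) (Fin N) ℂ))).re ≤ ν * t} ∧
    -Real.log ((haarProbability (Matrix.specialUnitaryGroup (Fin N) ℂ)).real
        {V : Matrix.specialUnitaryGroup (Fin N) ℂ | (Matrix.trace (1 - (V : Matrix (Fin N) (Fin N) ℂ))).re ≤ ν * t})
      ≤ -Real.log ((haarProbability (Matrix.specialUnitaryGroup (Fin N) ℂ)).real
        {V : Matrix.specialUnitaryGroup (Fin N) ℂ | (Matrix.trace (1 - (V : Matrix (Fin N) (Fin N) ℂ))).re ≤ t})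
        + c + ((N ^ 2 - 1 : ℕ) : ℝ) / 2 * Real.log ν₀⁻¹ := by
  obtain ⟨D, hD, h⟩ := exists_haarReal_traceWindow_doubling (N := N)
  have hD0 : 0 < D := by linarith
  refine ⟨Real.log D, Real.log_nonneg hD, fun ν₀ ν hν₀ hν hν1 t ht => ?_⟩
  set μ := haarProbability (Matrix.specialUnitaryGroup (Fin N) ℂ) with hμ
  have key := letter_live_of_doubling (D := D) (k := N ^ 2 - 1) (ν := ν) (ν₀ := ν₀) (t := t)
    (m := fun s => μ.real {V : Matrix.specialUnitaryGroup (Fin N) ℂ | (Matrix.trace (1 - (V : Matrix (Fin N) (Fin N) ℂ))).re ≤ s})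
    hD0 (fun l hl s => by
      show μ.real _ ≤ D * l ^ (N ^ 2 - 1) * μ.real _
      exact h l hl s) hν₀ hν hν1 (by simpa only using ht) le_rfl
  obtain ⟨hpos, hle⟩ := key
  exact ⟨by simpa only using hpos, by simpa only using hle⟩

variable {B : Type*} [Fintype B]

/-- Product window, product mass: `κ(Π_b W_t) = Haar(W_t)^{#B}` for the product Haar on `B → SU(N)` (Mathlib `Measure.pi_pi`). [folklore] -/
theorem pi_traceWindow_real_eq (t : ℝ) :
    ((Measure.pi fun _ : B => haarProbability (Matrix.specialUnitaryGroup (Fin N) ℂ))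
        (Set.univ.pi fun _ : B => {V : Matrix.specialUnitaryGroup (Fin N) ℂ | (Matrix.trace (1 - (V : Matrix (Fin N) (Fin N) ℂ))).re ≤ t})).toReal
      = ((haarProbability (Matrix.specialUnitaryGroup (Fin N) ℂ)).real
        {V : Matrix.specialUnitaryGroup (Fin N) ℂ | (Matrix.trace (1 - (V : Matrix (Fin N) (Fin N) ℂ))).re ≤ t}) ^ Fintype.card B := by
  rw [Measure.pi_pi, ENNReal.toReal_prod, Finset.prod_const, Finset.card_univ, measureReal_def]

/-- **A REGION AT A LIVE WINDOW, ALL `N`**: with V38's doubling constant `D`,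
`(√ν)^{(N²−1)·#B}·κ(Π_b W_t) ≤ D^{#B}·κ(Π_b W_{νt})` on the product Haar of `B → SU(N)`, all `0 < ν ≤ 1`, all real `t`. [folklore] -/
theorem exists_live_pi_traceWindow_ge : ∃ D : ℝ, 1 ≤ D ∧ ∀ ν : ℝ, 0 < ν → ν ≤ 1 → ∀ t : ℝ,
    (Real.sqrt ν ^ (N ^ 2 - 1)) ^ Fintype.card B *
      ((Measure.pi fun _ : B => haarProbability (Matrix.specialUnitaryGroup (Fin N) ℂ))
        (Set.univ.pi fun _ : B => {V : Matrix.specialUnitaryGroup (Fin N) ℂ | (Matrix.trace (1 - (V : Matrix (Fin N) (Fin N) ℂ))).re ≤ t})).toReal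
      ≤ D ^ Fintype.card B *
      ((Measure.pi fun _ : B => haarProbability (Matrix.specialUnitaryGroup (Fin N) ℂ))
        (Set.univ.pi fun _ : B => {V : Matrix.specialUnitaryGroup (Fin N) ℂ | (Matrix.trace (1 - (V : Matrix (Fin N) (Fin N) ℂ))).re ≤ ν * t})).toReal := by
  obtain ⟨D, hD, h⟩ := exists_live_traceWindow_ge (N := N)
  refine ⟨D, hD, fun ν hν0 hν1 t => ?_⟩
  rw [pi_traceWindow_real_eq, pi_traceWindow_real_eq, ← mul_pow, ← mul_pow]
  exact pow_le_pow_left₀ (mul_nonneg (pow_nonneg (Real.sqrt_nonneg _) _) measureReal_nonneg) (h ν hν0 hν1 t) _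

/-- **THE REGION'S LOG FORM ON THE GRID, ALL `N`**: there is `c ≥ 0` such that for every `ν₀ > 0`, `ν ∈ [ν₀, 1]`, every bond set `B` and every
trace window of positive Haar volume: `−log κ(Π_b W_{νt}) ≤ −log κ(Π_b W_t) + #B·(c + ((N² − 1)∕2)·log ν₀⁻¹)`. [folklore] -/
theorem exists_neg_log_live_pi_traceWindow_le : ∃ c : ℝ, 0 ≤ c ∧ ∀ ν₀ ν : ℝ, 0 < ν₀ → ν₀ ≤ ν → ν ≤ 1 → ∀ t : ℝ,
    0 < (haarProbability (Matrix.specialUnitaryGroup (Fin N) ℂ)).real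
        {V : Matrix.specialUnitaryGroup (Fin N) ℂ | (Matrix.trace (1 - (V : Matrix (Fin N) (Fin N) ℂ))).re ≤ t} →
    -Real.log ((Measure.pi fun _ : B => haarProbability (Matrix.specialUnitaryGroup (Fin N) ℂ))
        (Set.univ.pi fun _ : B => {V : Matrix.specialUnitaryGroup (Fin N) ℂ | (Matrix.trace (1 - (V : Matrix (Fin N) (Fin N) ℂ))).re ≤ ν * t})).toReal
      ≤ -Real.log ((Measure.pi fun _ : B => haarProbability (Matrix.specialUnitaryGroup (Fin N) ℂ))
        (Set.univ.pi fun _ : B => {V : Matrix.specialUnitaryGroup (Fin N) ℂ | (Matrix.trace (1 - (V : Matrix (Fin N) (Fin N) ℂ))).re ≤ t})).toReal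
        + (Fintype.card B : ℝ) * (c + ((N ^ 2 - 1 : ℕ) : ℝ) / 2 * Real.log ν₀⁻¹) := by
  obtain ⟨c, hc, h⟩ := exists_neg_log_live_traceWindow_le (N := N)
  refine ⟨c, hc, fun ν₀ ν hν₀ hν hν1 t ht => ?_⟩
  obtain ⟨hpos, hle⟩ := h ν₀ ν hν₀ hν hν1 t ht
  rw [pi_traceWindow_real_eq, pi_traceWindow_real_eq, Real.log_pow, Real.log_pow]
  have hn : (0 : ℝ) ≤ Fintype.card B := Nat.cast_nonneg _
  have := mul_le_mul_of_nonneg_left hle hn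
  linarith

end SUN

/-! ## §2 `SU(2)` SHARP: V40c's `D = 1` BY NAME — the live factor is exactly `ν^{3∕2}` per plaquette variable, no constant -/

section SU2

/-- **THE LIVE TRACE WINDOW ON `SU(2)` HOLDS `ν^{3∕2}` OF THE UNLOWERED ONE, CONSTANT `1`**:
`(√ν)³·Haar_{SU(2)}{Re tr(1 − V) ≤ t} ≤ Haar_{SU(2)}{Re tr(1 − V) ≤ ν·t}` for ALL `0 < ν ≤ 1` and ALL real `t`. [folklore] -/
theorem live_traceWindow_ge_sharp {ν : ℝ} (hν0 : 0 < ν) (hν1 : ν ≤ 1) (t : ℝ) :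
    Real.sqrt ν ^ 3 * (haarProbability (Matrix.specialUnitaryGroup (Fin 2) ℂ)).real
        {V : Matrix.specialUnitaryGroup (Fin 2) ℂ | (Matrix.trace (1 - (V : Matrix (Fin 2) (Fin 2) ℂ))).re ≤ t}
      ≤ (haarProbability (Matrix.specialUnitaryGroup (Fin 2) ℂ)).real
        {V : Matrix.specialUnitaryGroup (Fin 2) ℂ | (Matrix.trace (1 - (V : Matrix (Fin 2) (Fin 2) ℂ))).re ≤ ν * t} := by
  set μ := haarProbability (Matrix.specialUnitaryGroup (Fin 2) ℂ) with hμ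
  have key := live_lower_of_doubling (D := 1) (k := 3)
    (m := fun s => μ.real {V : Matrix.specialUnitaryGroup (Fin 2) ℂ | (Matrix.trace (1 - (V : Matrix (Fin 2) (Fin 2) ℂ))).re ≤ s})
    (fun l hl s => by
      show μ.real _ ≤ 1 * l ^ 3 * μ.real _
      rw [one_mul]; exact haarReal_traceWindow_doubling_one hl s) hν0 hν1 t
  simpa only [one_mul] using key

/-- **THE UNLOWERED LETTER VERBATIM PLUS `(3∕2)·log ν⁻¹`, NOTHING ELSE**: at a trace window of positive Haar volume and a live factor
`0 < ν ≤ 1`, the live window has positive volume and `−log Haar(W_{νt}) ≤ −log Haar(W_t) + (3∕2)·log ν⁻¹`. [folklore] -/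
theorem neg_log_live_traceWindow_le_sharp {ν t : ℝ} (hν0 : 0 < ν) (hν1 : ν ≤ 1)
    (ht : 0 < (haarProbability (Matrix.specialUnitaryGroup (Fin 2) ℂ)).real
        {V : Matrix.specialUnitaryGroup (Fin 2) ℂ | (Matrix.trace (1 - (V : Matrix (Fin 2) (Fin 2) ℂ))).re ≤ t}) :
    0 < (haarProbability (Matrix.specialUnitaryGroup (Fin 2) ℂ)).real
        {V : Matrix.specialUnitaryGroup (Fin 2) ℂ | (Matrix.trace (1 - (V : Matrix (Fin 2) (Fin 2) ℂ))).re ≤ ν * t} ∧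
    -Real.log ((haarProbability (Matrix.specialUnitaryGroup (Fin 2) ℂ)).real
        {V : Matrix.specialUnitaryGroup (Fin 2) ℂ | (Matrix.trace (1 - (V : Matrix (Fin 2) (Fin 2) ℂ))).re ≤ ν * t})
      ≤ -Real.log ((haarProbability (Matrix.specialUnitaryGroup (Fin 2) ℂ)).real
        {V : Matrix.specialUnitaryGroup (Fin 2) ℂ | (Matrix.trace (1 - (V : Matrix (Fin 2) (Fin 2) ℂ))).re ≤ t})
        + 3 / 2 * Real.log ν⁻¹ := by
  set μ := haarProbability (Matrix.specialUnitaryGroup (Fin 2) ℂ) with hμ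
  have key := neg_log_live_le_of_doubling (D := 1) (k := 3) (ν := ν) (t := t) one_pos
    (m := fun s => μ.real {V : Matrix.specialUnitaryGroup (Fin 2) ℂ | (Matrix.trace (1 - (V : Matrix (Fin 2) (Fin 2) ℂ))).re ≤ s})
    (fun l hl s => by
      show μ.real _ ≤ 1 * l ^ 3 * μ.real _
      rw [one_mul]; exact haarReal_traceWindow_doubling_one hl s) hν0 hν1 (by simpa only using ht)
  obtain ⟨hpos, h⟩ := key
  refine ⟨by simpa only using hpos, ?_⟩
  have h' : -Real.log (μ.real {V : Matrix.specialUnitaryGroup (Fin 2) ℂ | (Matrix.trace (1 - (V : Matrix (Fin 2) (Fin 2) ℂ))).re ≤ ν * t})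
      ≤ -Real.log (μ.real {V : Matrix.specialUnitaryGroup (Fin 2) ℂ | (Matrix.trace (1 - (V : Matrix (Fin 2) (Fin 2) ℂ))).re ≤ t})
        + Real.log 1 + ((3 : ℕ) : ℝ) / 2 * Real.log ν⁻¹ := by simpa only using h
  rw [Real.log_one] at h'
  rw [show ((3 : ℕ) : ℝ) / 2 = 3 / 2 by norm_num] at h'
  linarith

/-- **THE LETTER TRANSFER, SHARP** — [Balaban1989LargeFieldII] (1.10)'s shape at a live window: ANY valid volume letter
`−log Haar_{SU(2)}(W_t) ≤ L` (e.g. `L = (3∕2)·log g_k⁻² + log σ₀`, or files 24∕27's, or V33's explicit one) at a window of positive volume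
reads `−log Haar_{SU(2)}(W_{νt}) ≤ L + (3∕2)·log ν₀⁻¹` for EVERY `ν ∈ [ν₀, 1]`, `ν₀ > 0`: rate AND constant of `L` untouched, the live factor a
separate assignment-free summand, NO sandwich constant. [folklore] -/
theorem letter_live_sharp {ν ν₀ t L : ℝ} (hν₀ : 0 < ν₀) (hν : ν₀ ≤ ν) (hν1 : ν ≤ 1)
    (ht : 0 < (haarProbability (Matrix.specialUnitaryGroup (Fin 2) ℂ)).real
        {V : Matrix.specialUnitaryGroup (Fin 2) ℂ | (Matrix.trace (1 - (V : Matrix (Fin 2) (Fin 2) ℂ))).re ≤ t})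
    (hL : -Real.log ((haarProbability (Matrix.specialUnitaryGroup (Fin 2) ℂ)).real
        {V : Matrix.specialUnitaryGroup (Fin 2) ℂ | (Matrix.trace (1 - (V : Matrix (Fin 2) (Fin 2) ℂ))).re ≤ t}) ≤ L) :
    0 < (haarProbability (Matrix.specialUnitaryGroup (Fin 2) ℂ)).real
        {V : Matrix.specialUnitaryGroup (Fin 2) ℂ | (Matrix.trace (1 - (V : Matrix (Fin 2) (Fin 2) ℂ))).re ≤ ν * t} ∧
    -Real.log ((haarProbability (Matrix.specialUnitaryGroup (Fin 2) ℂ)).real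
        {V : Matrix.specialUnitaryGroup (Fin 2) ℂ | (Matrix.trace (1 - (V : Matrix (Fin 2) (Fin 2) ℂ))).re ≤ ν * t})
      ≤ L + 3 / 2 * Real.log ν₀⁻¹ := by
  obtain ⟨hpos, h⟩ := neg_log_live_traceWindow_le_sharp (hν₀.trans_le hν) hν1 ht
  exact ⟨hpos, by linarith [half_mul_log_inv_le (k := (3 : ℝ)) (by norm_num) hν₀ hν]⟩

variable {B : Type*} [Fintype B]

/-- **A REGION AT A LIVE WINDOW, SHARP**: `(√ν)^{3·#B}·κ(Π_b W_t) ≤ κ(Π_b W_{νt})` on the product Haar of `B → SU(2)`, all `0 < ν ≤ 1`, all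
real `t`. [folklore] -/
theorem live_pi_traceWindow_ge_sharp {ν : ℝ} (hν0 : 0 < ν) (hν1 : ν ≤ 1) (t : ℝ) :
    (Real.sqrt ν ^ 3) ^ Fintype.card B *
      ((Measure.pi fun _ : B => haarProbability (Matrix.specialUnitaryGroup (Fin 2) ℂ))
        (Set.univ.pi fun _ : B => {V : Matrix.specialUnitaryGroup (Fin 2) ℂ | (Matrix.trace (1 - (V : Matrix (Fin 2) (Fin 2) ℂ))).re ≤ t})).toReal
      ≤ ((Measure.pi fun _ : B => haarProbability (Matrix.specialUnitaryGroup (Fin 2) ℂ))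
        (Set.univ.pi fun _ : B => {V : Matrix.specialUnitaryGroup (Fin 2) ℂ | (Matrix.trace (1 - (V : Matrix (Fin 2) (Fin 2) ℂ))).re ≤ ν * t})).toReal := by
  rw [pi_traceWindow_real_eq, pi_traceWindow_real_eq, ← mul_pow]
  exact pow_le_pow_left₀ (mul_nonneg (pow_nonneg (Real.sqrt_nonneg _) _) measureReal_nonneg) (live_traceWindow_ge_sharp hν0 hν1 t) _

/-- **THE REGION'S LIVE PIN RELATIVE TO THE UNLOWERED LETTER, SHARP**: for every `ν₀ > 0`, `ν ∈ [ν₀, 1]`, every bond set `B` and every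
trace window of positive Haar volume, `−log κ(Π_b W_{νt}) ≤ −log κ(Π_b W_t) + #B·(3∕2)·log ν₀⁻¹` — files 24 ∕ 27's live region pins with
their sandwich constants (`log 16`; `log 160`) replaced by `0`: ONE assignment-free summand for the grid. [folklore] -/
theorem neg_log_live_pi_traceWindow_le_sharp {ν ν₀ t : ℝ} (hν₀ : 0 < ν₀) (hν : ν₀ ≤ ν) (hν1 : ν ≤ 1)
    (ht : 0 < (haarProbability (Matrix.specialUnitaryGroup (Fin 2) ℂ)).real
        {V : Matrix.specialUnitaryGroup (Fin 2) ℂ | (Matrix.trace (1 - (V : Matrix (Fin 2) (Fin 2) ℂ))).re ≤ t}) :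
    -Real.log ((Measure.pi fun _ : B => haarProbability (Matrix.specialUnitaryGroup (Fin 2) ℂ))
        (Set.univ.pi fun _ : B => {V : Matrix.specialUnitaryGroup (Fin 2) ℂ | (Matrix.trace (1 - (V : Matrix (Fin 2) (Fin 2) ℂ))).re ≤ ν * t})).toReal
      ≤ -Real.log ((Measure.pi fun _ : B => haarProbability (Matrix.specialUnitaryGroup (Fin 2) ℂ))
        (Set.univ.pi fun _ : B => {V : Matrix.specialUnitaryGroup (Fin 2) ℂ | (Matrix.trace (1 - (V : Matrix (Fin 2) (Fin 2) ℂ))).re ≤ t})).toReal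
        + (Fintype.card B : ℝ) * (3 / 2 * Real.log ν₀⁻¹) := by
  obtain ⟨hpos, hle⟩ := letter_live_sharp hν₀ hν hν1 ht le_rfl
  rw [pi_traceWindow_real_eq, pi_traceWindow_real_eq, Real.log_pow, Real.log_pow]
  have hn : (0 : ℝ) ≤ Fintype.card B := Nat.cast_nonneg _
  have := mul_le_mul_of_nonneg_left hle hn
  linarith

end SU2

/-! ## §3 The halved-action (LCS) letter of the reference state at live letters: threshold-FREE; its ledger clause by value -/

section LCS

/-- **A DEGREE-`0` STABILITY LETTER IS DOMINATED BY HALF THE LIVE FRACTION OF ANY EXTRACTION PROFILE, BELOW ONE `g⋆(λ₀)`.**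
V38's per-plaquette LCS letter `b₀ = ½d(𝔤)·log(1−δ)⁻¹ + c` does not grow with `ℓ = log g⁻²`; file 15's `dominance_live_of_g_small` at
`q = 0 < p` BY NAME gives `b₀ ≤ (λ₀²∕2)·A·ℓ(g)ᵖ` for `0 < g ≤ exp(−½·max 1 (2b₀∕(λ₀²A)))` — the live ledger's clause `b ≤ κ·a₁`,
`κ = λ₀²∕2`, with NO clause on `λ₀`. [folklore] -/
theorem lcsLetter_dominated_live_of_g_small {A b₀ lam₀ g : ℝ} {p : ℕ} (hA : 0 < A) (h0 : 0 < lam₀) (hp : 0 < p)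
    (hg0 : 0 < g) (hg : g ≤ Real.exp (-(max 1 (2 * b₀ / (lam₀ ^ 2 * A)) / 2))) :
    b₀ ≤ lam₀ ^ 2 / 2 * p0Profile A p g := by
  have h := dominance_live_of_g_small (B := b₀) (q := 0) hA h0 hp hg0 hg
  have e : p0Profile b₀ 0 g = b₀ := by unfold p0Profile; rw [pow_zero, mul_one]
  rwa [e] at h

/-- **THE `SU(2)` LCS LETTER (V40d, `c = 0`) IN THE LIVE LEDGER**: for `0 ≤ δ < 1`, an extraction profile `A·ℓᵖ` (`A > 0`, `p ≥ 1`) and a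
live factor floor `λ₀ > 0`: `(3∕2)·log(1−δ)⁻¹ ≤ (λ₀²∕2)·A·ℓ(g)ᵖ` for all `0 < g ≤ exp(−½·max 1 (2·((3∕2)log(1−δ)⁻¹)∕(λ₀²A)))` — V40d's
per-plaquette exponent sits under file 15's `κ = λ₀²∕2` below ONE `g⋆(λ₀)`; the letter itself (`lcsLetter_SU2_sharp`) names no threshold and
serves every assignment as it stands. [folklore] -/
theorem lcsLetter_SU2_dominated_live_of_g_small {A lam₀ g δ : ℝ} {p : ℕ} (hA : 0 < A) (h0 : 0 < lam₀) (hp : 0 < p)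
    (hg0 : 0 < g) (hg : g ≤ Real.exp (-(max 1 (2 * (3 / 2 * Real.log (1 - δ)⁻¹) / (lam₀ ^ 2 * A)) / 2))) :
    3 / 2 * Real.log (1 - δ)⁻¹ ≤ lam₀ ^ 2 / 2 * p0Profile A p g :=
  lcsLetter_dominated_live_of_g_small hA h0 hp hg0 hg

end LCS

/-! ## §4 Sanity -/

/-- At `ν = 1` the sharp live bound is `Haar(W_t) ≤ Haar(W_t)` (`√1 = 1`). -/
example (t : ℝ) :
    (haarProbability (Matrix.specialUnitaryGroup (Fin 2) ℂ)).real
        {V : Matrix.specialUnitaryGroup (Fin 2) ℂ | (Matrix.trace (1 - (V : Matrix (Fin 2) (Fin 2) ℂ))).re ≤ t}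
      ≤ (haarProbability (Matrix.specialUnitaryGroup (Fin 2) ℂ)).real
        {V : Matrix.specialUnitaryGroup (Fin 2) ℂ | (Matrix.trace (1 - (V : Matrix (Fin 2) (Fin 2) ℂ))).re ≤ 1 * t} := by
  have h := live_traceWindow_ge_sharp one_pos le_rfl t
  rwa [Real.sqrt_one, one_pow, one_mul] at h

end Summit.QuantumFields.BalabanUV.T4Continuum.Spine.NE7c.LiveFactorWindowDoubling

end
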